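import Mathlib
import Literature.NumberTheory.GaloisRepresentations.AbsGaloisOuterConj
import Literature.NumberTheory.GaloisRepresentations.SatakeFamilyOfFramedGaloisRep
import Literature.NumberTheory.GaloisRepresentations.HeckeCharacterGaloisAvatarProofs
import Literature.NumberTheory.GaloisRepresentations.HeckeCharacterOfRayClass
import Literature.NumberTheory.GaloisRepresentations.FramedRepTwist
import Literature.NumberTheory.Automorphic.SelfdualGL3AdjointLiftProofs
import Literature.NumberTheory.Automorphic.AutomorphicRepsGLSatakeFlathProofs
import Literature.NumberTheory.Automorphic.ChebotarevArtinRepHolds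
import Summits.Langlands.Langlands.Theorems.TwistUnpackaging.Negative.TwistSeparationOrder
import Literature.RepresentationTheory.Semisimple.Multiplicity
import Literature.RepresentationTheory.Semisimple.MultiplicityDecomposition
import Literature.RepresentationTheory.Semisimple.BrauerNesbitt
import Literature.RepresentationTheory.Semisimple.EquivOfCharacter
import Literature.NumberTheory.GaloisRepresentations.TwistedSumAssembly

/-!
# Finite-candidate gluing of `τ`-halvings — stub `stub_finiteCandidateGluing` of line
kummer-chebotarev-separating-twists (crux TwistUnpackaging, stmt-Langlands-10903)

Let `F/F₀` be a Galois extension of number fields, `t ∈ Γ_{F₀}`, `θ = θ_t : Γ_F → Γ_F` the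
continuous automorphism `absGaloisOuterConj F₀ F t`, and `A : Γ_F → GL_{2d}(ℚ̄_ℓ)` a continuous
semisimple (framed) Galois representation.  A *`τ`-halving* of `A` is a continuous semisimple
`ρ : Γ_F → GL_d(ℚ̄_ℓ)` with `det(X - A(g)) = det(X - ρ(g)) · det(X - ρ(θ g))` for all `g`, i.e.
`A ≅ ρ ⊕ ρ^θ` (Brauer–Nesbitt).  We prove (`stub_finiteCandidateGluing`): if for every *finite*
batch `T ⊆ G` of places there is a `τ`-halving whose Frobenius roots at the places of `T` are a
prescribed multiset `S w`, then one `τ`-halving has the prescribed Frobenius roots at *every*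
place of `G`.

Proof.  (1) For a halving `ρ`, `A ≅ ρ ⊕ ρ^θ` as representations on `ℚ̄_ℓ^{2d}`
(characteristic polynomials multiply over `⊕`, `LinearMap.charpoly_prodMap`; both sides are
semisimple; Brauer–Nesbitt in the characteristic-polynomial form,
`Representation.nonempty_equiv_of_charpoly_eq`), so `[ρ : U] ≤ [A : U]` for every irreducible `U`
(`mult_le_of_halving`).  (2) Decompose `A ≅ ⊕ᵢ Tᵢ` into finitely many irreducibles
(`Representation.exists_decomposition`).  Two halvings with the same multiplicities `[ρ : Tᵢ]`
have the same multiplicity of *every* irreducible (an irreducible not equivalent to a `Tᵢ` has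
multiplicity `0` in `A`, hence in both), so they are equivalent (Krull–Schmidt,
`Representation.nonempty_equiv_of_mult_eq`) and have the same characteristic polynomials
(`charpoly_eq_of_forall_mult_eq`).  Since `[ρ : Tᵢ] ≤ [A : Tᵢ] ≤ m`, the behaviour of a halving at
a place is governed by a vector in the finite set `Fin m → Fin (m + 1)`.  (3) Gluing (finite
intersection property in a finite set): the sets `Sol w` (`w ∈ G`) of vectors all of whose
halvings have the prescribed roots at `w` form a finite family of subsets of a finite set, so
`Sol '' G = Sol '' G₀` for a finite `G₀ ⊆ G` (`Set.exists_subset_image_finite_and`); the halving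
`ρ` supplied for the batch `G₀` has its vector in `Sol w'` for every `w' ∈ G₀`, hence in `Sol w`
for every `w ∈ G`, i.e. `ρ` has the prescribed roots everywhere on `G`.

Sources: Krull–Schmidt / multiplicities for semisimple modules (Curtis–Reiner, *Methods of
Representation Theory* I, (3.20)–(3.22)); Brauer–Nesbitt (Bourbaki, *Algèbre* VIII § 20 n° 6).
The tree's `TwistedSumAlgebraic` / `TwistedSumAssembly` are the template for the multiplicity
bookkeeping of framed representations.
-/

set_option linter.dupNamespace false -- project-wide option (lakefile weak.linter.dupNamespace); `Summit.Langlands.Langlands` is the mandated namespace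

open Literature.NumberTheory.GaloisRepresentations Literature.NumberTheory.Automorphic
open IsDedekindDomain NumberField Filter
open Literature.RepresentationTheory.Semisimple

namespace Summit.Langlands.Langlands.Theorems.TwistUnpackaging.KummerChebotarev

/-- **A halving is a sub-sum of `A`.**  If `ρ` is a `τ`-halving of the semisimple `A`
(`det(X - A g) = det(X - ρ g) · det(X - ρ (θ_t g))`, `ρ` semisimple), then `A ≅ ρ ⊕ ρ^{θ_t}` as
representations of `Γ_F` (Brauer–Nesbitt, characteristic-polynomial form), hence
`[ρ : U] ≤ [ρ : U] + [ρ^{θ_t} : U] = [A : U]` for every finite-dimensional `U`. [folklore] -/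
theorem mult_le_of_halving {F₀ F : Type} [Field F₀] [Field F] [NumberField F] [Algebra F₀ F]
    [IsGalois F₀ F] (t : Field.absoluteGaloisGroup F₀) {ℓ : ℕ} [Fact ℓ.Prime] {d : ℕ}
    (A : FramedGaloisRep F (PadicAlgCl ℓ) (2 * d)) (hA : A.toGaloisRep.IsSemisimple)
    (ρ : FramedGaloisRep F (PadicAlgCl ℓ) d) (hρ : ρ.toGaloisRep.IsSemisimple)
    (hid : ∀ g : Field.absoluteGaloisGroup F, FramedRep.charpoly A g =
      FramedRep.charpoly ρ g * FramedRep.charpoly ρ (absGaloisOuterConj F₀ F t g))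
    {X : Type*} [AddCommGroup X] [Module (PadicAlgCl ℓ) X] [FiniteDimensional (PadicAlgCl ℓ) X]
    (U : Representation (PadicAlgCl ℓ) (Field.absoluteGaloisGroup F) X) :
    Representation.mult U ρ.toRepresentation ≤ Representation.mult U A.toRepresentation := by
  haveI : A.toRepresentation.IsSemisimpleRepresentation := hA
  haveI : ρ.toRepresentation.IsSemisimpleRepresentation := hρ
  haveI : (ρ.outerConj t).toRepresentation.IsSemisimpleRepresentation :=
    (FramedGaloisRep.isSemisimple_outerConj_iff t ρ).2 hρ
  obtain ⟨e⟩ := Representation.nonempty_equiv_of_charpoly_eq A.toRepresentation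
    (ρ.toRepresentation.prod (ρ.outerConj t).toRepresentation) fun g => by
      rw [← FramedRep.charpoly_eq_charpoly_toRepresentation, hid g,
        show (ρ.toRepresentation.prod (ρ.outerConj t).toRepresentation) g =
          (ρ.toRepresentation g).prodMap ((ρ.outerConj t).toRepresentation g) from rfl,
        LinearMap.charpoly_prodMap, ← FramedRep.charpoly_eq_charpoly_toRepresentation,
        ← FramedRep.charpoly_eq_charpoly_toRepresentation, FramedGaloisRep.charpoly_outerConj]
  rw [Representation.mult_congr_right U e, Representation.mult_prod]
  exact Nat.le_add_right _ _

/-- **Equal multiplicities give equal characteristic polynomials.**  Two semisimple framed Galois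
representations of the same rank in which every finite-dimensional irreducible `U` has the same
multiplicity are equivalent (Krull–Schmidt, `Representation.nonempty_equiv_of_mult_eq`), hence
have the same characteristic polynomials (`LinearEquiv.charpoly_conj`). [folklore] -/
theorem charpoly_eq_of_forall_mult_eq {F : Type} [Field F] {ℓ : ℕ} [Fact ℓ.Prime] {d : ℕ}
    (ρ ρ' : FramedGaloisRep F (PadicAlgCl ℓ) d) (hρ : ρ.toGaloisRep.IsSemisimple)
    (hρ' : ρ'.toGaloisRep.IsSemisimple)
    (h : ∀ {X : Type} [AddCommGroup X] [Module (PadicAlgCl ℓ) X]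
      [FiniteDimensional (PadicAlgCl ℓ) X]
      (U : Representation (PadicAlgCl ℓ) (Field.absoluteGaloisGroup F) X) [U.IsIrreducible],
      Representation.mult U ρ.toRepresentation = Representation.mult U ρ'.toRepresentation)
    (g : Field.absoluteGaloisGroup F) : FramedRep.charpoly ρ g = FramedRep.charpoly ρ' g := by
  haveI : ρ.toRepresentation.IsSemisimpleRepresentation := hρ
  haveI : ρ'.toRepresentation.IsSemisimpleRepresentation := hρ'
  obtain ⟨e⟩ := Representation.nonempty_equiv_of_mult_eq ρ.toRepresentation ρ'.toRepresentation h
  rw [FramedRep.charpoly_eq_charpoly_toRepresentation, FramedRep.charpoly_eq_charpoly_toRepresentation]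
  exact (Representation.nonempty_equiv_iff_charpoly_eq _ _).1 ⟨e⟩ g

/-- **Finite-candidate gluing** (stub E of line kummer-chebotarev-separating-twists).  Let
`A : Γ_F → GL_{2d}(ℚ̄_ℓ)` be continuous semisimple and `θ_t` the outer conjugation of `Γ_F` by
`t ∈ Γ_{F₀}`.  If for every finite batch `T ⊆ G` of places there is a semisimple `τ`-halving
`ρ_T` of `A` (`det(X - A g) = det(X - ρ_T g) · det(X - ρ_T (θ_t g))`) whose Frobenius roots at every
`w ∈ T` are the prescribed `S w`, then one semisimple `τ`-halving of `A` has Frobenius roots `S w`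
at every `w ∈ G`.  Proof: halvings are sub-sums of the finitely many irreducible constituents
`Tᵢ` of `A` (`mult_le_of_halving`, `Representation.exists_decomposition`), and the vector of
multiplicities `([ρ : Tᵢ])ᵢ ∈ Fin m → Fin (m + 1)` determines the characteristic polynomials of
a halving (`charpoly_eq_of_forall_mult_eq`); the family of solution sets `Sol w ⊆ (Fin m → Fin
(m + 1))`, `w ∈ G`, is finite, so it is already realised on a finite `G₀ ⊆ G`
(`Set.exists_subset_image_finite_and`), and the halving supplied for the batch `G₀` works for all
of `G` (finite intersection property in a finite set). [folklore] -/
theorem stub_finiteCandidateGluing :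
    ∀ (F₀ F : Type) [Field F₀] [NumberField F₀] [Field F] [NumberField F] [Algebra F₀ F]
      [IsGalois F₀ F] (t : Field.absoluteGaloisGroup F₀)
      (ℓ : ℕ) [Fact ℓ.Prime] (d : ℕ) (A : FramedGaloisRep F (PadicAlgCl ℓ) (2 * d)),
      A.toGaloisRep.IsSemisimple →
    ∀ (G : Set (HeightOneSpectrum (𝓞 F))) (S : HeightOneSpectrum (𝓞 F) → Multiset (PadicAlgCl ℓ)),
      (∀ T : Finset (HeightOneSpectrum (𝓞 F)), (↑T : Set (HeightOneSpectrum (𝓞 F))) ⊆ G →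
        ∃ ρ : FramedGaloisRep F (PadicAlgCl ℓ) d, ρ.toGaloisRep.IsSemisimple ∧
          (∀ g : Field.absoluteGaloisGroup F, FramedRep.charpoly A g =
              FramedRep.charpoly ρ g * FramedRep.charpoly ρ (absGaloisOuterConj F₀ F t g)) ∧
          ∀ w ∈ T, ∀ 𝔓 ∈ w.primesAbove, ∀ σ : Field.absoluteGaloisGroup F,
            IsArithFrobAt (𝓞 F) σ 𝔓 → (FramedRep.charpoly ρ σ).roots = S w) →
    ∃ ρ : FramedGaloisRep F (PadicAlgCl ℓ) d, ρ.toGaloisRep.IsSemisimple ∧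
      (∀ g : Field.absoluteGaloisGroup F, FramedRep.charpoly A g =
          FramedRep.charpoly ρ g * FramedRep.charpoly ρ (absGaloisOuterConj F₀ F t g)) ∧
      ∀ w ∈ G, ∀ 𝔓 ∈ w.primesAbove, ∀ σ : Field.absoluteGaloisGroup F,
        IsArithFrobAt (𝓞 F) σ 𝔓 → (FramedRep.charpoly ρ σ).roots = S w := by
  intro F₀ F _ _ _ _ _ _ t ℓ _ d A hA G S hT
  classical
  haveI hAss : A.toRepresentation.IsSemisimpleRepresentation := hA
  /- Step 1: the finitely many irreducible constituents `T i` of `A`. -/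
  obtain ⟨m, T, -, hTirr, hcount⟩ := Representation.exists_decomposition A.toRepresentation
  -- multiplicities of the constituents in a halving are bounded by `m`
  have hbound : ∀ ρ : FramedGaloisRep F (PadicAlgCl ℓ) d, ρ.toGaloisRep.IsSemisimple →
      (∀ g : Field.absoluteGaloisGroup F, FramedRep.charpoly A g =
        FramedRep.charpoly ρ g * FramedRep.charpoly ρ (absGaloisOuterConj F₀ F t g)) →
      ∀ i, Representation.mult (T i).toRepresentation ρ.toRepresentation < m + 1 := by
    intro ρ hρ hid i
    haveI := hTirr i
    refine Nat.lt_succ_of_le ((mult_le_of_halving t A hA ρ hρ hid _).trans ?_)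
    rw [hcount (T i).toRepresentation]
    exact (Finset.card_filter_le _ _).trans (by simp)
  /- Step 2: halvings with the same multiplicities of the constituents have the same
  characteristic polynomials. -/
  have hkey : ∀ ρ ρ' : FramedGaloisRep F (PadicAlgCl ℓ) d, ρ.toGaloisRep.IsSemisimple →
      ρ'.toGaloisRep.IsSemisimple →
      (∀ g : Field.absoluteGaloisGroup F, FramedRep.charpoly A g =
        FramedRep.charpoly ρ g * FramedRep.charpoly ρ (absGaloisOuterConj F₀ F t g)) →
      (∀ g : Field.absoluteGaloisGroup F, FramedRep.charpoly A g =
        FramedRep.charpoly ρ' g * FramedRep.charpoly ρ' (absGaloisOuterConj F₀ F t g)) →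
      (∀ i, Representation.mult (T i).toRepresentation ρ.toRepresentation =
        Representation.mult (T i).toRepresentation ρ'.toRepresentation) →
      ∀ g : Field.absoluteGaloisGroup F, FramedRep.charpoly ρ g = FramedRep.charpoly ρ' g := by
    intro ρ ρ' hρ hρ' hid hid' hv
    refine charpoly_eq_of_forall_mult_eq ρ ρ' hρ hρ' ?_
    intro X _ _ _ U _
    by_cases hU : ∃ i, Nonempty (Representation.Equiv U (T i).toRepresentation)
    · obtain ⟨i, ⟨e⟩⟩ := hU
      rw [Representation.mult_congr_left e, Representation.mult_congr_left e]
      exact hv i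
    · have h0 : Representation.mult U A.toRepresentation = 0 := by
        rw [hcount U, Finset.card_eq_zero, Finset.filter_eq_empty_iff]
        exact fun i _ hi => hU ⟨i, hi⟩
      have h1 := mult_le_of_halving t A hA ρ hρ hid U
      have h2 := mult_le_of_halving t A hA ρ' hρ' hid' U
      omega
  /- Step 3: gluing — finite intersection property in the finite set `Fin m → Fin (m + 1)`. -/
  let Sol : HeightOneSpectrum (𝓞 F) → Set (Fin m → Fin (m + 1)) := fun w =>
    {v | ∀ ρ : FramedGaloisRep F (PadicAlgCl ℓ) d, ρ.toGaloisRep.IsSemisimple →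
      (∀ g : Field.absoluteGaloisGroup F, FramedRep.charpoly A g =
        FramedRep.charpoly ρ g * FramedRep.charpoly ρ (absGaloisOuterConj F₀ F t g)) →
      (∀ i, Representation.mult (T i).toRepresentation ρ.toRepresentation = (v i : ℕ)) →
      ∀ 𝔓 ∈ w.primesAbove, ∀ σ : Field.absoluteGaloisGroup F,
        IsArithFrobAt (𝓞 F) σ 𝔓 → (FramedRep.charpoly ρ σ).roots = S w}
  obtain ⟨G₀, hG₀G, hG₀fin, hG₀eq⟩ :=
    (Set.exists_subset_image_finite_and (f := Sol) (s := G) (p := fun 𝒮 => 𝒮 = Sol '' G)).1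
      ⟨Sol '' G, subset_rfl, Set.toFinite _, rfl⟩
  obtain ⟨ρ, hρ, hid, hgood⟩ := hT hG₀fin.toFinset fun w hw => hG₀G (hG₀fin.mem_toFinset.1 hw)
  refine ⟨ρ, hρ, hid, fun w hw 𝔓 h𝔓 σ hσ => ?_⟩
  -- the multiplicity vector of `ρ` solves every `w' ∈ G₀`, hence every `w ∈ G`
  let v₀ : Fin m → Fin (m + 1) := fun i => ⟨_, hbound ρ hρ hid i⟩
  have hv₀ : ∀ w' ∈ G₀, v₀ ∈ Sol w' := by
    intro w' hw' ρ' hρ' hid' hv' 𝔓' h𝔓' σ' hσ'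
    rw [hkey ρ' ρ hρ' hρ hid' hid hv' σ']
    exact hgood w' (hG₀fin.mem_toFinset.2 hw') 𝔓' h𝔓' σ' hσ'
  have hw' : Sol w ∈ Sol '' G₀ := by
    rw [hG₀eq]
    exact Set.mem_image_of_mem Sol hw
  obtain ⟨w', hw'G₀, hww'⟩ := hw'
  have h := hv₀ w' hw'G₀
  rw [hww'] at h
  exact h ρ hρ hid (fun i => rfl) 𝔓 h𝔓 σ hσ

end Summit.Langlands.Langlands.Theorems.TwistUnpackaging.KummerChebotarev
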